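import Mathlib.RingTheory.MvPolynomial.WeightedHomogeneous
import Mathlib.RingTheory.FiniteType
import Mathlib.RingTheory.RegularLocalRing.Polynomial
import Mathlib.Algebra.Order.Antidiag.Finsupp
import Literature.AlgebraicGeometry.Resolution.AffineBlowupAlgebra
import Literature.AlgebraicGeometry.Resolution.AffineBlowup
import HarnessLib

/-!
# Membership criterion for the Veronese subring

Support file for crux stmt-ResolutionOfSingularities-15317 (`FrobeniusLadder.FRationalResolution`), line `redirect`,
lead c5, CONE PROGRAMME (rung 4′ in all dimensions on the Veronese cones `V(n,r) = Spec k[χᵈ : |d| = r]`).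
We prove the membership criterion for the `r`-th Veronese subring
`VR(n,r) = k[χᵈ : |d| = r] ⊆ k[x₁,…,xₙ]`: a polynomial lies in `VR(n,r)` iff every monomial in its
support has total degree divisible by `r` — given the (purely combinatorial) splitting of exponent
vectors of total degree `r·s` into sums of `s` exponent vectors of total degree `r`, which is taken
as a hypothesis. (`→`: induction over `Algebra.adjoin`, degrees add on products of monomials;
`←`: a monomial of degree `r·s` is a product of `s` degree-`r` monomials, and a polynomial is the
`k`-combination of its monomials.) [folklore]
-/

-- single-problem summit: the doubled namespace component is forced
set_option linter.dupNamespace false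

noncomputable section

namespace Summit.ResolutionOfSingularities.ResolutionOfSingularities.Theorems.FRationalResolution

open MvPolynomial
open Literature.AlgebraicGeometry.Resolution

section Cones

variable (k : Type) [Field k]

/-- The polynomial ring in `n` variables. -/
local notation3 "MP[" n "]" => MvPolynomial (Fin n) k

/-- The `r`-th Veronese subring of `k[x₁,…,xₙ]`: the `k`-subalgebra generated by the degree-`r` monomials. -/
local notation3 "VR[" n ", " r "]" =>
  Algebra.adjoin k ((fun d : Fin n →₀ ℕ => MvPolynomial.monomial d (1 : k)) ''
    {d : Fin n →₀ ℕ | Finsupp.degree d = (r : ℕ)})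

/-- The vertex ideal of the Veronese cone: spanned by the degree-`r` monomials. -/
local notation3 "VM[" n ", " r "]" =>
  Ideal.span {v : ↥VR[n, r] | ∃ d : Fin n →₀ ℕ, Finsupp.degree d = (r : ℕ) ∧
    (v : MvPolynomial (Fin n) k) = MvPolynomial.monomial d 1}

/-- Every element of the Veronese subring `VR[n, r]` has all the monomials of its support of total
degree divisible by `r`. Induction over `Algebra.adjoin` (`Algebra.adjoin_induction`): a generator is
a single monomial of degree `r`; a constant has support `⊆ {0}`; a sum has support in the union of
the supports; a product has support in the pointwise sum of the supports (`MvPolynomial.support_mul`),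
and the total degree `Finsupp.degree` is additive. [folklore] -/
theorem veroneseMemIff_dvd_degree_of_mem (n r : ℕ) {f : MP[n]} (hf : f ∈ VR[n, r]) :
    ∀ d ∈ f.support, r ∣ Finsupp.degree d := by
  classical
  induction hf using Algebra.adjoin_induction with
  | mem x hx =>
    obtain ⟨e, he, rfl⟩ := hx
    intro d hd
    have hd' : d = e := Finset.mem_singleton.mp (support_monomial_subset hd)
    rw [hd', show Finsupp.degree e = r from he]
  | algebraMap c =>
    intro d hd
    rw [MvPolynomial.algebraMap_eq, C_apply] at hd
    have hd' : d = 0 := Finset.mem_singleton.mp (support_monomial_subset hd)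
    rw [hd', map_zero]
    exact dvd_zero r
  | add x y _ _ hx hy =>
    intro d hd
    rcases Finset.mem_union.mp (support_add hd) with h | h
    · exact hx d h
    · exact hy d h
  | mul x y _ _ hx hy =>
    intro d hd
    obtain ⟨a, ha, b, hb, rfl⟩ := Finset.mem_add.mp (support_mul x y hd)
    rw [map_add]
    exact dvd_add (hx a ha) (hy b hb)

/-- A polynomial all of whose monomials have total degree divisible by `r` lies in the Veronese
subring `VR[n, r]`, provided every exponent vector of total degree `r·s` splits as a sum of `s`
exponent vectors of total degree `r`: write `f = ∑_{d ∈ supp f} (coeff d f) • χᵈ`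
(`MvPolynomial.as_sum`); for `|d| = r·s` and `d = ∑ⱼ eⱼ` with `|eⱼ| = r` one has
`χᵈ = ∏ⱼ χ^{eⱼ}` (`MvPolynomial.monomial_sum_index`), a product of generators. [folklore] -/
theorem veroneseMemIff_mem_of_dvd_degree (n r : ℕ)
    (hsplit : ∀ (s : ℕ) (d : Fin n →₀ ℕ), Finsupp.degree d = r * s →
      ∃ e : Fin s → (Fin n →₀ ℕ), (∀ j, Finsupp.degree (e j) = r) ∧ d = ∑ j, e j)
    {f : MP[n]} (hf : ∀ d ∈ f.support, r ∣ Finsupp.degree d) : f ∈ VR[n, r] := by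
  rw [f.as_sum]
  refine Subalgebra.sum_mem _ (fun d hd => ?_)
  obtain ⟨s, hs⟩ := hf d hd
  obtain ⟨e, he, hde⟩ := hsplit s d hs
  rw [hde, monomial_sum_index, C_mul']
  refine Subalgebra.smul_mem _ (Subalgebra.prod_mem _ (fun j _ => ?_)) _
  exact Algebra.subset_adjoin ⟨e j, he j, rfl⟩

/-- **Membership criterion for the Veronese subring.** For `1 ≤ r`, a polynomial `f ∈ k[x₁,…,xₙ]`
lies in the `r`-th Veronese subring `VR[n, r] = k[χᵈ : |d| = r]` iff every monomial in its support
has total degree divisible by `r`. (`→`: `Algebra.adjoin_induction`, degrees add on products of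
monomials; `←`: a monomial of degree `r·s` is a product of `s` degree-`r` monomials by the splitting
hypothesis `hsplit`, and `f` is the `k`-combination of its monomials.) The hypothesis `1 ≤ r` is not
needed for the equivalence itself (for `r = 0` both sides say that `f` is a constant).
[folklore; cf. Bruns–Herzog 1998 §6.1, Goto–Watanabe 1978 §3] -/
theorem stub_veronese_mem_iff (n r : ℕ) (hr : 1 ≤ r)
    (hsplit : ∀ (s : ℕ) (d : Fin n →₀ ℕ), Finsupp.degree d = r * s →
      ∃ e : Fin s → (Fin n →₀ ℕ), (∀ j, Finsupp.degree (e j) = r) ∧ d = ∑ j, e j)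
    (f : MP[n]) : f ∈ VR[n, r] ↔ ∀ d ∈ f.support, r ∣ Finsupp.degree d := by
  have _ := hr
  exact ⟨veroneseMemIff_dvd_degree_of_mem k n r, veroneseMemIff_mem_of_dvd_degree k n r hsplit⟩

end Cones

end Summit.ResolutionOfSingularities.ResolutionOfSingularities.Theorems.FRationalResolution

end
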